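import Summits.QuantumFields.Balaban3D.Proofs.StandardAC

/-!
# `Summit.QuantumFields.Balaban3D.Proofs.TrivMassAC` — the trivial history's mass chain of the AC tower: the INTEGRAL of the floored chain
# (`∫ m_k(triv) dV ≤ k + 1`) and the WINDOWED RAW TRANSPORT `𝟙_{Wn}·T_k[m_k(triv)]` (the trivial weight of `WindowAC.ineq41_windowed_succ_ae`)
# — lane `pub-balaban3d`, seat alpha-1 (crux `HistoryTailL` of route `UnitScaleTilt`, line v5p3, STUB 2‴)

WHY.  `MassesAC.massRecAC` floors the trivial history at `1` at EVERY level (`m_{k+1}(triv) = max 1 (T_k[m_k(triv)])`, `w_k(triv) ≡ 1`); for an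
averaging that is merely absolutely continuous (`T_k[1] ≠ 1`) the floors COMPOUND: the only bound the tree can give is `∫ m_k(triv) ≤ k + 1`
(§1; each floor adds at most the unit mass, the transport preserves `∫`).  The windowed weight the frozen (β) row delivers at level `k + 1` is
`𝟙_{Wn}·T_k[m_k(triv)]` (§2: `≥ 0`, `≤ m_{k+1}(triv)`, measurable, integrable, `∫ ≤ k + 1`, supported in `Wn` POINTWISE).  Seat finding
F-α1-11: a cut-off-uniform bound (`∫ ≤ 2`, as STUB 2‴ of line v5p3 asks) needs the chain unfloored below level `k`, i.e. the (β) residual in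
mass-generic form — not derivable from the package of record.  [folklore] measure theory; nothing of [Balaban1985UV3] is asserted.

References: T. Bałaban, Commun. Math. Phys. 102 (1985) 255–275 [Balaban1985UV3] ((40)–(41) p.266, (48) p.268).
-/

noncomputable section

namespace Summit.QuantumFields.Balaban3D.Proofs.TrivMassAC

open _root_.MeasureTheory
open Literature.MathematicalPhysics.QuantumFieldTheory.Balaban1983to89
open Literature.MathematicalPhysics.QuantumFieldTheory.Balaban1983to89.AveragingRT (rnTransport rnTransport_nonneg)
open Summit.QuantumFields.Balaban3D.Carriers
open Summit.QuantumFields.Balaban3D.Proofs.MassesAC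

variable {P : Params} {G : Type} [GaugeGroup G] [MeasurableSpace G] [HaarData G]
  (M₁ : ℕ) (Rcol : ℕ → ℕ) (εL εS : ℕ → ℝ) (av : ∀ j, Averaging P j G)

/-! ## §1 The integral of the floored trivial chain -/

/-- **`∫ m_k(triv) dV ≤ k + 1`** for the floored exact-transport masses over an absolutely continuous averaging family: `m_0 = 1`;
`m_{k+1}(triv) = max 1 (T_k[w·m_k(triv)]) ≤ 1 + T_k[w·m_k(triv)]`, the transport preserves the integral (`Carriers.integral_rnTransport_of_ac`) and
`w ≤ 1`.  (For a Haar-compatible averaging `m_k(triv) = 1` a.e.; for `AvgAC` only, this linear bound is all the floors allow.) [folklore] -/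
theorem integral_massRecAC_triv_le [RegularGaugeGroup G] (hav : ∀ j, AvgAC (av j).avg) :
    ∀ k : ℕ, ∫ V, massRecAC M₁ Rcol εL εS av k (Hist.triv P k) V ∂(fieldMeasure P k G) ≤ (k : ℝ) + 1
  | 0 => by simp [massRecAC_zero]
  | k + 1 => by
    have ih := integral_massRecAC_triv_le hav k
    have hwm : Integrable (fun U => stepWeight M₁ Rcol εL εS k (Hist.triv P (k + 1)) U *
        massRecAC M₁ Rcol εL εS av k (Hist.triv P k) U) (fieldMeasure P k G) := by
      have := integrable_stepWeight_mul M₁ Rcol εL εS k (Hist.triv P (k + 1)) (integrable_massRecAC M₁ Rcol εL εS av k (Hist.triv P k))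
      simpa [Hist.proj_triv] using this
    have hT : Integrable (rnTransport (av k).avg (fun U => stepWeight M₁ Rcol εL εS k (Hist.triv P (k + 1)) U *
        massRecAC M₁ Rcol εL εS av k (Hist.triv P k) U)) (fieldMeasure P (k + 1) G) :=
      integrable_rnTransport _ _ hwm
    have hle : ∀ V, massRecAC M₁ Rcol εL εS av (k + 1) (Hist.triv P (k + 1)) V ≤
        1 + rnTransport (av k).avg (fun U => stepWeight M₁ Rcol εL εS k (Hist.triv P (k + 1)) U *
          massRecAC M₁ Rcol εL εS av k (Hist.triv P k) U) V := by
      intro V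
      rw [massRecAC_triv_succ]
      have h0 : 0 ≤ rnTransport (av k).avg (fun U => stepWeight M₁ Rcol εL εS k (Hist.triv P (k + 1)) U *
          massRecAC M₁ Rcol εL εS av k (Hist.triv P k) U) V :=
        rnTransport_nonneg _ _ (fun U => mul_nonneg (stepWeight_nonneg M₁ Rcol εL εS k _ U)
          (massRecAC_nonneg M₁ Rcol εL εS av k _ U)) V
      exact max_le (by linarith) (by linarith)
    have hwle : ∀ U, stepWeight M₁ Rcol εL εS k (Hist.triv P (k + 1)) U * massRecAC M₁ Rcol εL εS av k (Hist.triv P k) U ≤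
        massRecAC M₁ Rcol εL εS av k (Hist.triv P k) U := fun U => by
      have h1 := stepWeight_le_one M₁ Rcol εL εS k (Hist.triv P (k + 1)) U
      have h0 := massRecAC_nonneg M₁ Rcol εL εS av k (Hist.triv P k) U
      nlinarith
    calc ∫ V, massRecAC M₁ Rcol εL εS av (k + 1) (Hist.triv P (k + 1)) V ∂(fieldMeasure P (k + 1) G)
        ≤ ∫ V, (1 + rnTransport (av k).avg (fun U => stepWeight M₁ Rcol εL εS k (Hist.triv P (k + 1)) U *
            massRecAC M₁ Rcol εL εS av k (Hist.triv P k) U) V) ∂(fieldMeasure P (k + 1) G) :=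
          integral_mono (integrable_massRecAC M₁ Rcol εL εS av (k + 1) _) ((integrable_const _).add hT) hle
      _ = 1 + ∫ U, stepWeight M₁ Rcol εL εS k (Hist.triv P (k + 1)) U *
            massRecAC M₁ Rcol εL εS av k (Hist.triv P k) U ∂(fieldMeasure P k G) := by
          rw [integral_add (integrable_const _) hT, integral_rnTransport_of_ac (hav k) _ hwm]
          simp
      _ ≤ 1 + ∫ U, massRecAC M₁ Rcol εL εS av k (Hist.triv P k) U ∂(fieldMeasure P k G) := by
          have := integral_mono hwm (integrable_massRecAC M₁ Rcol εL εS av k _) hwle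
          linarith
      _ ≤ (((k + 1 : ℕ)) : ℝ) + 1 := by push_cast; linarith

/-! ## §2 The windowed raw transport of the trivial chain -/

variable (Wn : ∀ k, Set (GaugeField P (k + 1) G))

/-- **THE WINDOWED TRIVIAL WEIGHT** at level `k`: `1` at `k = 0` ((41)₀ = (1) p.256 carries no characteristic function), and
`𝟙_{Wn k}(V)·T_k[m_k(triv)](V)` at level `k + 1` — the RAW (unfloored) transport of the floored trivial mass, windowed. [cite: Balaban1985UV3, (40)–(41) p.266] -/
def trivWt : (k : ℕ) → GaugeField P k G → ℝ
  | 0, _ => 1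
  | k + 1, V => (Wn k).indicator (fun _ => (1 : ℝ)) V * rnTransport (av k).avg (massRecAC M₁ Rcol εL εS av k (Hist.triv P k)) V

/-- `trivWt 0 = 1`. [folklore] -/
theorem trivWt_zero (V : GaugeField P 0 G) : trivWt M₁ Rcol εL εS av Wn 0 V = 1 := rfl

/-- `trivWt (k+1) V = 𝟙_{Wn k}(V)·T_k[m_k(triv)](V)`. [folklore] -/
theorem trivWt_succ (k : ℕ) (V : GaugeField P (k + 1) G) :
    trivWt M₁ Rcol εL εS av Wn (k + 1) V =
      (Wn k).indicator (fun _ => (1 : ℝ)) V * rnTransport (av k).avg (massRecAC M₁ Rcol εL εS av k (Hist.triv P k)) V := rfl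

/-- `trivWt ≥ 0`. [folklore] -/
theorem trivWt_nonneg : ∀ (k : ℕ) (V : GaugeField P k G), 0 ≤ trivWt M₁ Rcol εL εS av Wn k V
  | 0, _ => zero_le_one
  | k + 1, V => mul_nonneg (Set.indicator_nonneg (fun _ _ => zero_le_one) V)
      (rnTransport_nonneg _ _ (massRecAC_nonneg M₁ Rcol εL εS av k _) V)

/-- **SUPPORT, POINTWISE**: `trivWt (k+1) V ≠ 0 ⇒ V ∈ Wn k`. [folklore] -/
theorem mem_of_trivWt_succ_ne_zero (k : ℕ) (V : GaugeField P (k + 1) G) (h : trivWt M₁ Rcol εL εS av Wn (k + 1) V ≠ 0) :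
    V ∈ Wn k := by
  by_contra hV
  exact h (by rw [trivWt_succ, Set.indicator_of_notMem hV, zero_mul])

/-- **THE WINDOWED WEIGHT IS BELOW THE LANE'S FLOORED TRIVIAL MASS**, pointwise: `trivWt k ≤ m_k(triv)` (in the standing range `k ≤ m + K`, where
`w_{k−1}(triv) ≡ 1`). [folklore] -/
theorem trivWt_le_massRecAC : ∀ (k : ℕ), k ≤ P.m + P.K → ∀ (V : GaugeField P k G),
    trivWt M₁ Rcol εL εS av Wn k V ≤ massRecAC M₁ Rcol εL εS av k (Hist.triv P k) V
  | 0, _, V => by rw [trivWt_zero, massRecAC_zero]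
  | k + 1, hk, V => by
    rw [trivWt_succ, massRecAC_triv_succ]
    have hw : (fun U => stepWeight M₁ Rcol εL εS k (Hist.triv P (k + 1)) U * massRecAC M₁ Rcol εL εS av k (Hist.triv P k) U) =
        massRecAC M₁ Rcol εL εS av k (Hist.triv P k) := by
      funext U; rw [stepWeight_triv M₁ Rcol εL εS (by omega) U, one_mul]
    rw [hw]
    have h0 := rnTransport_nonneg (av k).avg _ (massRecAC_nonneg M₁ Rcol εL εS av k (Hist.triv P k)) V
    have hi : (Wn k).indicator (fun _ => (1 : ℝ)) V ≤ 1 := Set.indicator_le_self' (fun _ _ => zero_le_one) V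
    calc (Wn k).indicator (fun _ => (1 : ℝ)) V * rnTransport (av k).avg (massRecAC M₁ Rcol εL εS av k (Hist.triv P k)) V
        ≤ 1 * rnTransport (av k).avg (massRecAC M₁ Rcol εL εS av k (Hist.triv P k)) V := mul_le_mul_of_nonneg_right hi h0
      _ ≤ _ := by rw [one_mul]; exact le_max_right _ _

/-- `trivWt` is measurable (`Wn` measurable). [folklore] -/
theorem measurable_trivWt (hWn : ∀ k, MeasurableSet (Wn k)) : ∀ k : ℕ, Measurable (trivWt M₁ Rcol εL εS av Wn k)
  | 0 => measurable_const
  | k + 1 => ((measurable_const.indicator (hWn k)).mul (measurable_rnTransport _ _) : Measurable fun V =>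
      (Wn k).indicator (fun _ => (1 : ℝ)) V * rnTransport (av k).avg (massRecAC M₁ Rcol εL εS av k (Hist.triv P k)) V)

/-- `trivWt` is integrable. [folklore] -/
theorem integrable_trivWt [RegularGaugeGroup G] (hWn : ∀ k, MeasurableSet (Wn k)) : ∀ k : ℕ, Integrable (trivWt M₁ Rcol εL εS av Wn k) (fieldMeasure P k G)
  | 0 => integrable_const _
  | k + 1 => by
    have hT : Integrable (rnTransport (av k).avg (massRecAC M₁ Rcol εL εS av k (Hist.triv P k))) (fieldMeasure P (k + 1) G) :=
      integrable_rnTransport _ _ (integrable_massRecAC M₁ Rcol εL εS av k _)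
    refine hT.bdd_mul (measurable_const.indicator (hWn k)).aestronglyMeasurable (c := 1) (ae_of_all _ fun V => ?_)
    by_cases hV : V ∈ Wn k <;> simp [Set.indicator, hV]

/-- **`∫ trivWt k dV ≤ max k 1`**: `∫ trivWt 0 = 1`, and `∫ trivWt (k+1) ≤ ∫ T_k[m_k(triv)] = ∫ m_k(triv) ≤ k + 1` (§1).  Linear in the level —
the compounded floors; NOT uniform in the cut-off (seat finding F-α1-11). [folklore] -/
theorem integral_trivWt_le [RegularGaugeGroup G] (hav : ∀ j, AvgAC (av j).avg) (hWn : ∀ k, MeasurableSet (Wn k)) :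
    ∀ k : ℕ, ∫ V, trivWt M₁ Rcol εL εS av Wn k V ∂(fieldMeasure P k G) ≤ max (k : ℝ) 1
  | 0 => by simp [trivWt_zero]
  | k + 1 => by
    have hm := integrable_massRecAC M₁ Rcol εL εS av k (Hist.triv P k)
    have hT : Integrable (rnTransport (av k).avg (massRecAC M₁ Rcol εL εS av k (Hist.triv P k))) (fieldMeasure P (k + 1) G) :=
      integrable_rnTransport _ _ hm
    have hle : ∀ V, trivWt M₁ Rcol εL εS av Wn (k + 1) V ≤ rnTransport (av k).avg (massRecAC M₁ Rcol εL εS av k (Hist.triv P k)) V := by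
      intro V
      rw [trivWt_succ]
      have h0 := rnTransport_nonneg (av k).avg _ (massRecAC_nonneg M₁ Rcol εL εS av k (Hist.triv P k)) V
      have hi : (Wn k).indicator (fun _ => (1 : ℝ)) V ≤ 1 := Set.indicator_le_self' (fun _ _ => zero_le_one) V
      nlinarith
    calc ∫ V, trivWt M₁ Rcol εL εS av Wn (k + 1) V ∂(fieldMeasure P (k + 1) G)
        ≤ ∫ V, rnTransport (av k).avg (massRecAC M₁ Rcol εL εS av k (Hist.triv P k)) V ∂(fieldMeasure P (k + 1) G) :=
          integral_mono (integrable_trivWt M₁ Rcol εL εS av Wn hWn (k + 1)) hT hle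
      _ = ∫ U, massRecAC M₁ Rcol εL εS av k (Hist.triv P k) U ∂(fieldMeasure P k G) := integral_rnTransport_of_ac (hav k) _ hm
      _ ≤ (k : ℝ) + 1 := integral_massRecAC_triv_le M₁ Rcol εL εS av hav k
      _ ≤ max (((k + 1 : ℕ)) : ℝ) 1 := by push_cast; exact le_max_left _ _

end Summit.QuantumFields.Balaban3D.Proofs.TrivMassAC

end
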